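import Mathlib
import Summits.ValiantsHypothesis.ValiantsHypothesis.Theorems.TriangularDimersDivisionEasy.Negative.Placement

/-!
# `TriangularDimersDivisionEasy` — negative-side toolkit 3b: reading and regluing a cover in the gadget

Crux `stmt-ValiantsHypothesis-5067` (`Theses.DivisionGap.TriangularDimersDivisionEasy`, route
DivisionGap).  Standing disprover (cdisprove gen 1); geometry of the load-bearing lemma
`false_without_division` (Valiant 1980, Thm 1, for the rhombus), continued from `Placement.lean`.
For a dimer cover `f` of `R_n` and a validly placed ball:
* `outS f` — the boundary vertices of the copy that `f` matches to the outside;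
* `pull f` — `f` read inside the copy, a perfect matching of `ball ∖ outS f` (`pull_isPMOn`), so
  `outS f` is even (`even_length_outS`);
* `glue f g` — `f` with its inside replaced by any perfect matching `g` of `ball ∖ outS f`: again a
  dimer cover (`glue_mem_dimers`), equal to `f` off the copy (`glue_apply_of_not_inBall`);
* `exists_two_covers` — by the gadget lemma there are two dimer covers agreeing with `f` off the copy,
  one USING the centre edge and one NOT using it.
[folklore]
-/

namespace Summit.ValiantsHypothesis.ValiantsHypothesis.Theorems.TriangularDimersDivisionEasy.Negative

open scoped BigOperators

set_option linter.dupNamespace false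

noncomputable section

open Classical

variable {n : ℕ}

section Placed

variable (hn : 0 < n) (o : Bool) (c : ℤ × ℤ)

/-! ## A dimer cover read inside the placed ball -/

variable (f : Vtx n → Vtx n)

/-- Boundary offsets whose placed vertex is matched by `f` to a vertex outside the placed ball. [folklore] -/
def outS : List ℕ := bdryI.filter fun i => decide (¬ InBall hn o c (f (vtx hn o c i)))

/-- `outS` is a sublist of the boundary list. [folklore] -/
theorem outS_sublist : (outS hn o c f).Sublist bdryI := List.filter_sublist

/-- Membership in `outS`. [folklore] -/
theorem mem_outS {i : ℕ} : i ∈ outS hn o c f ↔ i ∈ bdryI ∧ ¬ InBall hn o c (f (vtx hn o c i)) := by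
  simp [outS]

/-- `outS` has no repetition. [folklore] -/
theorem outS_nodup : (outS hn o c f).Nodup := bdryI_nodup.filter _

/-- `f` pulled back to ball indices (identity where undefined). [folklore] -/
def pull (i : ℕ) : ℕ :=
  if h : i < 44 ∧ InBall hn o c (f (vtx hn o c i)) then Classical.choose h.2 else i

/-- Specification of `pull` on indices matched inside the ball. [folklore] -/
theorem pull_spec {i : ℕ} (hi : i < 44) (hin : InBall hn o c (f (vtx hn o c i))) :
    pull hn o c f i < 44 ∧ vtx hn o c (pull hn o c f i) = f (vtx hn o c i) := by
  have h : i < 44 ∧ InBall hn o c (f (vtx hn o c i)) := ⟨hi, hin⟩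
  simp only [pull, dif_pos h]
  exact Classical.choose_spec h.2

/-- `pull` is the identity elsewhere. [folklore] -/
theorem pull_of_not {i : ℕ} (h : ¬ (i < 44 ∧ InBall hn o c (f (vtx hn o c i)))) : pull hn o c f i = i := by
  simp only [pull, dif_neg h]

/-- The inside list: ball indices not matched outward. [folklore] -/
def insideL : List ℕ := (List.range 44).filter fun i => !((outS hn o c f).contains i)

/-- Membership in the inside list. [folklore] -/
theorem mem_insideL {i : ℕ} : i ∈ insideL hn o c f ↔ i < 44 ∧ i ∉ outS hn o c f := by
  simp [insideL]

/-- For a dimer cover, every inside index is matched inside the ball. [folklore] -/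
theorem inBall_apply_of_mem_insideL (hV : Valid n o c) (hf : f ∈ dimers n) {i : ℕ}
    (hi : i ∈ insideL hn o c f) : InBall hn o c (f (vtx hn o c i)) := by
  rw [mem_insideL] at hi
  by_cases hb : i ∈ bdryI
  · by_contra hnot
    exact hi.2 ((mem_outS hn o c f).2 ⟨hb, hnot⟩)
  · rw [dimers, Finset.mem_filter] at hf
    exact inBall_of_adj_interior hn o c hV hi.1 hb (hf.2 (vtx hn o c i)).2.2

/-- **Restriction.** A dimer cover of `R_n`, read inside a validly placed ball, is a perfect matching of
the inside list. [folklore] -/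
theorem pull_isPMOn (hV : Valid n o c) (hf : f ∈ dimers n) :
    IsPMOn adjI (insideL hn o c f) (pull hn o c f) := by
  have hd : IsDimer f := (Finset.mem_filter.1 hf).2
  refine ⟨fun i hi => ?_, fun i hi => ?_⟩
  · have hin := inBall_apply_of_mem_insideL hn o c f hV hf hi
    rw [mem_insideL] at hi
    obtain ⟨hj, hvj⟩ := pull_spec hn o c f hi.1 hin
    set j := pull hn o c f i with hjdef
    -- f (vtx j) = vtx i
    have hfj : f (vtx hn o c j) = vtx hn o c i := by rw [hvj, (hd _).1]
    have hinj : InBall hn o c (f (vtx hn o c j)) := by rw [hfj]; exact inBall_vtx hn o c hi.1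
    refine ⟨?_, ?_, ?_, ?_⟩
    · rw [mem_insideL]
      refine ⟨hj, fun hout => ?_⟩
      exact ((mem_outS hn o c f).1 hout).2 hinj
    · intro hji
      apply (hd (vtx hn o c i)).2.1
      rw [← hvj, hji]
    · obtain ⟨hk, hvk⟩ := pull_spec hn o c f hj hinj
      exact vtx_inj hn o c hV hk hi.1 (by rw [hvk, hfj])
    · rw [← adj_vtx_iff hn o c hV hi.1 hj, hvj]
      exact (hd _).2.2
  · apply pull_of_not
    rintro ⟨hi44, hin⟩
    apply hi
    rw [mem_insideL]
    refine ⟨hi44, fun hout => ?_⟩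
    exact ((mem_outS hn o c f).1 hout).2 hin

/-- The inside list has `44 - |outS f|` elements. [folklore] -/
theorem length_insideL_add : (insideL hn o c f).length + (outS hn o c f).length = 44 := by
  have hperm := List.filter_append_perm (fun i => !((outS hn o c f).contains i)) (List.range 44)
  have hlen := hperm.length_eq
  rw [List.length_append, List.length_range] at hlen
  have h2 : ((List.range 44).filter fun i => !!((outS hn o c f).contains i)).Perm (outS hn o c f) := by
    rw [List.perm_ext_iff_of_nodup (List.nodup_range.filter _) (outS_nodup hn o c f)]
    intro a
    simp only [Bool.not_not, List.mem_filter, List.mem_range, List.contains_iff_mem, and_iff_right_iff_imp]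
    intro ha
    exact mem_bdryI_lt a ((outS_sublist hn o c f).subset ha)
  rw [h2.length_eq] at hlen
  exact hlen

/-- Hence the outward-matched boundary set of a dimer cover is even. [folklore] -/
theorem even_length_outS (hV : Valid n o c) (hf : f ∈ dimers n) : Even (outS hn o c f).length := by
  have h1 : Even (insideL hn o c f).length :=
    IsPMOn.even_length adjI ((List.nodup_range).filter _) (pull_isPMOn hn o c f hV hf)
  have h2 := length_insideL_add hn o c f
  obtain ⟨m, hm⟩ := h1
  exact ⟨22 - m, by omega⟩

/-! ## Gluing a perfect matching of the inside into a dimer cover -/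

/-- `f` with its inside replaced by `g`. [folklore] -/
def glue (g : ℕ → ℕ) (x : Vtx n) : Vtx n :=
  if h : ∃ i, i ∈ insideL hn o c f ∧ vtx hn o c i = x then vtx hn o c (g (Classical.choose h)) else f x

/-- `glue` on inside placed vertices follows `g`. [folklore] -/
theorem glue_apply_vtx (hV : Valid n o c) (g : ℕ → ℕ) {i : ℕ} (hi : i ∈ insideL hn o c f) :
    glue hn o c f g (vtx hn o c i) = vtx hn o c (g i) := by
  have h : ∃ j, j ∈ insideL hn o c f ∧ vtx hn o c j = vtx hn o c i := ⟨i, hi, rfl⟩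
  simp only [glue, dif_pos h]
  have hs := Classical.choose_spec h
  have : Classical.choose h = i :=
    vtx_inj hn o c hV ((mem_insideL hn o c f).1 hs.1).1 ((mem_insideL hn o c f).1 hi).1 hs.2
  rw [this]

/-- `glue` agrees with `f` off the inside placed vertices. [folklore] -/
theorem glue_apply_of_not (g : ℕ → ℕ) {x : Vtx n} (hx : ¬ ∃ i, i ∈ insideL hn o c f ∧ vtx hn o c i = x) :
    glue hn o c f g x = f x := by
  simp only [glue, dif_neg hx]

/-- `glue` agrees with `f` outside the placed ball. [folklore] -/
theorem glue_apply_of_not_inBall (g : ℕ → ℕ) {x : Vtx n} (hx : ¬ InBall hn o c x) :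
    glue hn o c f g x = f x := by
  apply glue_apply_of_not
  rintro ⟨i, hi, rfl⟩
  exact hx (inBall_vtx hn o c ((mem_insideL hn o c f).1 hi).1)

/-- **Gluing.** Replacing the inside of a dimer cover by any perfect matching of the inside list gives a
dimer cover. [folklore] -/
theorem glue_mem_dimers (hV : Valid n o c) (hf : f ∈ dimers n) {g : ℕ → ℕ}
    (hg : IsPMOn adjI (insideL hn o c f) g) : glue hn o c f g ∈ dimers n := by
  have hd : IsDimer f := (Finset.mem_filter.1 hf).2
  rw [dimers, Finset.mem_filter]
  refine ⟨Finset.mem_univ _, fun x => ?_⟩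
  by_cases hx : ∃ i, i ∈ insideL hn o c f ∧ vtx hn o c i = x
  · obtain ⟨i, hi, rfl⟩ := hx
    obtain ⟨g1, g2, g3, g4⟩ := hg.1 i hi
    have hi44 := ((mem_insideL hn o c f).1 hi).1
    have hgi44 := ((mem_insideL hn o c f).1 g1).1
    rw [glue_apply_vtx hn o c f hV g hi, glue_apply_vtx hn o c f hV g g1, g3]
    refine ⟨rfl, fun h => g2 (vtx_inj hn o c hV hgi44 hi44 h), ?_⟩
    exact (adj_vtx_iff hn o c hV hi44 hgi44).2 g4
  · rw [glue_apply_of_not hn o c f g hx]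
    have hfx : ¬ ∃ i, i ∈ insideL hn o c f ∧ vtx hn o c i = f x := by
      rintro ⟨j, hj, hjx⟩
      -- then `x = f (f x) = f (vtx j)` lies in the ball, at an inside index: contradiction with `hx`
      have hin := inBall_apply_of_mem_insideL hn o c f hV hf hj
      rw [hjx, (hd x).1] at hin
      obtain ⟨i, hi44, rfl⟩ := hin
      apply hx
      refine ⟨i, (mem_insideL hn o c f).2 ⟨hi44, fun hout => ?_⟩, rfl⟩
      have := ((mem_outS hn o c f).1 hout).2
      rw [← hjx] at this
      exact this (inBall_vtx hn o c ((mem_insideL hn o c f).1 hj).1)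
    rw [glue_apply_of_not hn o c f g hfx]
    exact hd x

/-! ## Two covers differing exactly in the use of the centre edge -/

/-- The centre edge `{18, 25}` and the rhombus vertices `19, 12` are inside indices of every dimer
cover (they are not boundary vertices). [folklore] -/
theorem mem_insideL_of_mem_qI {i : ℕ} (hi : i ∈ qI) : i ∈ insideL hn o c f := by
  rw [mem_insideL]
  exact ⟨mem_qI_lt i hi, fun h => qI_not_mem_bdryI i hi ((outS_sublist hn o c f).subset h)⟩

/-- **Two covers.** For a dimer cover `f` and a validly placed ball there are dimer covers `f₁`, `f₂`
that agree with `f` outside the ball, with `f₂ u = v` and `f₁ u ≠ v` for the centre edge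
`u = vtx 18`, `v = vtx 25`. [folklore] -/
theorem exists_two_covers (hV : Valid n o c) (hf : f ∈ dimers n) :
    ∃ f₁ ∈ dimers n, ∃ f₂ ∈ dimers n,
      (∀ x, ¬ InBall hn o c x → f₁ x = f x) ∧ (∀ x, ¬ InBall hn o c x → f₂ x = f x) ∧
      f₁ (vtx hn o c 18) ≠ vtx hn o c 25 ∧ f₂ (vtx hn o c 18) = vtx hn o c 25 := by
  -- the gadget lemma gives a perfect matching `g₀` of `ball ∖ Q ∖ outS f`
  obtain ⟨g₀, hg₀⟩ := gadget_pm (outS hn o c f) (fun i hi => (outS_sublist hn o c f).subset hi)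
    (outS_nodup hn o c f) (even_length_outS hn o c f hV hf)
  have hnd0 : (ballMinusQ.filter fun i => !((outS hn o c f).contains i)).Nodup :=
    (List.nodup_range.filter _).filter _
  have hmem0 : ∀ i, i ∈ (ballMinusQ.filter fun i => !((outS hn o c f).contains i)) ↔
      (i < 44 ∧ i ∉ qI) ∧ i ∉ outS hn o c f := by
    intro i
    simp only [ballMinusQ, List.mem_filter, List.mem_range, Bool.not_eq_eq_eq_not, Bool.not_true]
    rw [Bool.eq_false_iff, Bool.eq_false_iff, ne_eq, ne_eq, List.contains_iff_mem, List.contains_iff_mem]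
  have hq : ∀ i ∈ qI, i ∉ (ballMinusQ.filter fun i => !((outS hn o c f).contains i)) := by
    intro i hi h; exact ((hmem0 i).1 h).1.2 hi
  obtain ⟨c1, c2, c3, c4⟩ := rhombus_cycle
  -- f₁-inside: g₀ + {18–12, 19–25};  f₂-inside: g₀ + {18–25, 12–19}
  have h18 : (18 : ℕ) ∈ qI := by decide
  have h25 : (25 : ℕ) ∈ qI := by decide
  have h19 : (19 : ℕ) ∈ qI := by decide
  have h12 : (12 : ℕ) ∈ qI := by decide
  -- non-membership of rhombus indices in the extended lists
  have hq1 : ∀ i ∈ qI, ∀ a : ℕ, i ≠ a →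
      i ∉ a :: (ballMinusQ.filter fun i => !((outS hn o c f).contains i)) :=
    fun i hi a hia => List.not_mem_cons_of_ne_of_not_mem hia (hq i hi)
  have hq2 : ∀ i ∈ qI, ∀ a b : ℕ, i ≠ a → i ≠ b →
      i ∉ a :: b :: (ballMinusQ.filter fun i => !((outS hn o c f).contains i)) :=
    fun i hi a b hia hib => List.not_mem_cons_of_ne_of_not_mem hia (hq1 i hi b hib)
  -- first extension: g₀ + {19–25} + {18–12};  second: g₀ + {12–19} + {18–25}
  have hA := IsPMOn.insert_pair adjI hnd0 hg₀ (hq 19 h19) (hq 25 h25) (by decide) c3 adjI_symm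
  have hA' := IsPMOn.insert_pair adjI (List.nodup_cons.2 ⟨hq1 19 h19 25 (by decide), List.nodup_cons.2
    ⟨hq 25 h25, hnd0⟩⟩) hA (a := 18) (b := 12)
    (hq2 18 h18 19 25 (by decide) (by decide)) (hq2 12 h12 19 25 (by decide) (by decide)) (by decide) c1 adjI_symm
  have hB := IsPMOn.insert_pair adjI hnd0 hg₀ (hq 12 h12) (hq 19 h19) (by decide) c2 adjI_symm
  have hB' := IsPMOn.insert_pair adjI (List.nodup_cons.2 ⟨hq1 12 h12 19 (by decide), List.nodup_cons.2
    ⟨hq 19 h19, hnd0⟩⟩) hB (a := 18) (b := 25)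
    (hq2 18 h18 12 19 (by decide) (by decide)) (hq2 25 h25 12 19 (by decide) (by decide)) (by decide)
    (by rw [adjI_symm]; exact c4) adjI_symm
  -- both are perfect matchings of the inside list (same members)
  have hmemI : ∀ (a b a' b' : ℕ), [a, b, a', b'].Perm qI → ∀ i,
      i ∈ a :: b :: a' :: b' :: (ballMinusQ.filter fun i => !((outS hn o c f).contains i)) ↔
        i ∈ insideL hn o c f := by
    intro a b a' b' hp i
    rw [mem_insideL]
    have hq' : i ∈ qI ↔ i = a ∨ i = b ∨ i = a' ∨ i = b' := by
      rw [← hp.mem_iff]; simp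
    simp only [List.mem_cons, hmem0]
    constructor
    · rintro (rfl | rfl | rfl | rfl | ⟨⟨h1, -⟩, h2⟩)
      · exact (mem_insideL hn o c f).1 (mem_insideL_of_mem_qI hn o c f (hq'.2 (Or.inl rfl)))
      · exact (mem_insideL hn o c f).1 (mem_insideL_of_mem_qI hn o c f (hq'.2 (Or.inr (Or.inl rfl))))
      · exact (mem_insideL hn o c f).1 (mem_insideL_of_mem_qI hn o c f (hq'.2 (Or.inr (Or.inr (Or.inl rfl)))))
      · exact (mem_insideL hn o c f).1 (mem_insideL_of_mem_qI hn o c f (hq'.2 (Or.inr (Or.inr (Or.inr rfl)))))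
      · exact ⟨h1, h2⟩
    · rintro ⟨h1, h2⟩
      by_cases hiq : i ∈ qI
      · rcases hq'.1 hiq with h | h | h | h
        · exact Or.inl h
        · exact Or.inr (Or.inl h)
        · exact Or.inr (Or.inr (Or.inl h))
        · exact Or.inr (Or.inr (Or.inr (Or.inl h)))
      · exact Or.inr (Or.inr (Or.inr (Or.inr ⟨⟨h1, hiq⟩, h2⟩)))
  have hgA := IsPMOn.of_mem_iff (hmemI 18 12 19 25 (by decide)) hA'
  have hgB := IsPMOn.of_mem_iff (hmemI 18 25 12 19 (by decide)) hB'
  refine ⟨glue hn o c f _, glue_mem_dimers hn o c f hV hf hgA, glue hn o c f _, glue_mem_dimers hn o c f hV hf hgB,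
    fun x hx => glue_apply_of_not_inBall hn o c f _ hx, fun x hx => glue_apply_of_not_inBall hn o c f _ hx, ?_, ?_⟩
  · rw [glue_apply_vtx hn o c f hV _ (mem_insideL_of_mem_qI hn o c f h18)]
    intro h
    have := vtx_inj hn o c hV (by norm_num) (by norm_num) h
    simp at this
  · rw [glue_apply_vtx hn o c f hV _ (mem_insideL_of_mem_qI hn o c f h18)]
    simp

end Placed

end

end Summit.ValiantsHypothesis.ValiantsHypothesis.Theorems.TriangularDimersDivisionEasy.Negative
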